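import Mathlib

/-!
# `SnSubsetDichotomy.ThresholdSubsetTriples`, line `triality-uniquely-cubing-translate` — stub `stub_chainProductCard`

Unique factorisation along a subgroup chain (registered stub `stub_chainProductCard` of crux
`stmt-MatrixMultiplication-10882`, shared infrastructure of the lines
`triality-uniquely-cubing-translate` and `SketchIdeator2`).  For an antitone chain of subgroups
`K 0 ≥ K 1 ≥ ⋯ ≥ K k` of a group `G` and finite sets `R j ⊆ K j` (`j < k`) that are partial left
transversals of `K (j+1)` in `K j` (`r⁻¹ r' ∈ K (j+1)`, `r, r' ∈ R j ⇒ r = r'`), the multiplication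
map `R 0 × ⋯ × R (k-1) → G` is injective, so the chain product `R 0 ⋯ R (k-1)` has exactly
`∏ |R j|` elements (folklore; Sims' stabiliser chains).

The definition `chainProd` is the line's (verbatim): the ordered pointwise product
`(List.ofFn R).prod`.  The proof is the textbook induction on `k`: `chainProd R = R 0 * chainProd
(j ↦ R (j+1))` (`List.ofFn_succ`), the tail product lies in the subgroup `K 1` (antitonicity), so
`r x = r' x'` forces `r⁻¹ r' = x x'⁻¹ ∈ K 1`, hence `r = r'` and `x = x'`; the tail is handled by
the induction hypothesis for the shifted chain `j ↦ K (j+1)`, and `Finset.card_mul_iff` turns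
injectivity into the cardinality identity.
-/

namespace Summit.MatrixMultiplication.MatrixMultiplication.Theorems.ThresholdSubsetTriples

open scoped Pointwise

section Defs

variable {G : Type*} [Group G] [DecidableEq G]

/-- The chain product `R 0 · R 1 ⋯ R (k-1)` of finitely many finite sets (pointwise products, in this
order). -/
def chainProd {k : ℕ} (R : Fin k → Finset G) : Finset G :=
  (List.ofFn R).prod

/-- The empty chain product is the one-element set `1 = {1}`. -/
theorem chainProd_zero (R : Fin 0 → Finset G) : chainProd R = 1 := by
  unfold chainProd
  rw [List.ofFn_zero, List.prod_nil]

/-- Peeling off the first factor: `R 0 ⋯ R k = R 0 * (R 1 ⋯ R k)`. -/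
theorem chainProd_succ {k : ℕ} (R : Fin (k + 1) → Finset G) :
    chainProd R = R 0 * chainProd (fun j : Fin k => R j.succ) := by
  unfold chainProd
  rw [List.ofFn_succ, List.prod_cons]

/-- If every factor lies in a subgroup `H`, so does the chain product. -/
theorem chainProd_subset_subgroup (H : Subgroup G) :
    ∀ {k : ℕ} (R : Fin k → Finset G), (∀ j, ∀ r ∈ R j, r ∈ H) → ∀ x ∈ chainProd R, x ∈ H := by
  intro k
  induction k with
  | zero =>
    intro R _ x hx
    rw [chainProd_zero, Finset.mem_one] at hx
    rw [hx]
    exact H.one_mem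
  | succ k ih =>
    intro R hR x hx
    rw [chainProd_succ, Finset.mem_mul] at hx
    obtain ⟨r, hr, y, hy, rfl⟩ := hx
    exact H.mul_mem (hR 0 r hr) (ih (fun j => R j.succ) (fun j r hr => hR j.succ r hr) y hy)

/-- The cardinality of a pointwise product `A * T` is `|A| * |T|` as soon as `T` lies in a subgroup
`H` and `A` is a partial left transversal of `H` (`a⁻¹ a' ∈ H`, `a, a' ∈ A ⇒ a = a'`). -/
theorem card_mul_of_transversal (A T : Finset G) (H : Subgroup G) (hT : ∀ x ∈ T, x ∈ H)
    (hA : ∀ a ∈ A, ∀ a' ∈ A, a⁻¹ * a' ∈ H → a = a') : (A * T).card = A.card * T.card := by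
  rw [Finset.card_mul_iff]
  rintro ⟨a, x⟩ hax ⟨a', x'⟩ hax' h
  simp only [Set.mem_prod, Finset.mem_coe] at hax hax'
  simp only at h
  -- `h : a * x = a' * x'`
  have key : a⁻¹ * a' = x * x'⁻¹ := by
    rw [inv_mul_eq_iff_eq_mul, ← mul_assoc, eq_mul_inv_iff_mul_eq]
    exact h.symm
  have hmem : a⁻¹ * a' ∈ H := by
    rw [key]
    exact H.mul_mem (hT x hax.2) (H.inv_mem (hT x' hax'.2))
  have haa' : a = a' := hA a hax.1 a' hax'.1 hmem
  subst haa'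
  have hxx' : x = x' := mul_left_cancel h
  subst hxx'
  rfl

end Defs

/-- **Stub `stub_chainProductCard` (unique factorisation along a subgroup chain).**  For an
antitone chain of subgroups `K 0 ≥ K 1 ≥ ⋯ ≥ K k` of a group `G` and finite sets `R j ⊆ K j`
(`j < k`) that are partial left transversals of `K (j+1)` in `K j` (`r⁻¹ r' ∈ K (j+1)`,
`r, r' ∈ R j ⇒ r = r'`), the chain product `R 0 ⋯ R (k-1)` has exactly `∏ |R j|` elements, i.e. the
multiplication map `R 0 × ⋯ × R (k-1) → G` is injective.  Proof by induction on `k` along the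
shifted chain `j ↦ K (j+1)`, the step being `card_mul_of_transversal` with `H = K 1 ⊇ R 1 ⋯ R (k-1)`.
[folklore: Sims 1970 / Schreier–Sims stabiliser chains] -/
theorem stub_chainProductCard : ∀ (G : Type) [Group G] [DecidableEq G] (k : ℕ) (K : Fin (k + 1) → Subgroup G) (R : Fin k → Finset G), Antitone K → (∀ j : Fin k, ∀ r ∈ R j, r ∈ K j.castSucc) → (∀ j : Fin k, ∀ r ∈ R j, ∀ r' ∈ R j, r⁻¹ * r' ∈ K j.succ → r = r') → (chainProd R).card = ∏ j, (R j).card := by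
  intro G _ _ k
  induction k with
  | zero =>
    intro K R _ _ _
    rw [chainProd_zero, Finset.card_one, Fin.prod_univ_zero]
  | succ k ih =>
    intro K R hK hRK hRT
    rw [chainProd_succ, Fin.prod_univ_succ]
    -- the tail `R 1 ⋯ R k` along the shifted chain `j ↦ K (j+1)`
    have htail : (chainProd (fun j : Fin k => R j.succ)).card = ∏ j : Fin k, (R j.succ).card :=
      ih (fun i => K i.succ) (fun j => R j.succ)
        (fun a b hab => hK (Fin.succ_le_succ_iff.mpr hab))
        (fun j r hr => by
          have h := hRK j.succ r hr
          rwa [← Fin.succ_castSucc] at h)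
        (fun j r hr r' hr' h => hRT j.succ r hr r' hr' h)
    rw [← htail]
    -- the tail lies in `K 1 = K (0 : Fin (k+1)).succ`
    have hT : ∀ x ∈ chainProd (fun j : Fin k => R j.succ), x ∈ K (0 : Fin (k + 1)).succ := by
      refine chainProd_subset_subgroup (K (0 : Fin (k + 1)).succ) (fun j : Fin k => R j.succ) ?_
      intro j r hr
      have hle : (0 : Fin (k + 1)).succ ≤ j.succ.castSucc := by
        rw [Fin.le_def]
        simp
      exact hK hle (hRK j.succ r hr)
    exact card_mul_of_transversal (R 0) _ (K (0 : Fin (k + 1)).succ) hT (hRT 0)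

end Summit.MatrixMultiplication.MatrixMultiplication.Theorems.ThresholdSubsetTriples
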